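import Summits.QuantumFields.BalabanUV.T4Continuum.Support.ScalarAveragedCompression
import Summits.QuantumFields.BalabanUV.T4Continuum.Support.ScalarMassTower
import Summits.QuantumFields.BalabanUV.T4Continuum.Support.ScalarPlantingDefect
import Summits.QuantumFields.BalabanUV.T4Continuum.Support.KroneckerLift

/-!
# T⁴ programme, spine node NE2 (U1a), tier B support row B4.c, file 4 — THE KRONECKER BRIDGE between the 0-form scalar layer
# (`LapS`, `PiS`, `DeltaPs`, `Gps` on `T^{(k)}`) and its componentwise realisation on the VECTOR index of the route
# (`B5Prop11Lower.Lap`, row B4.d's `ScalarMassTower.Kproj` on `idx L M k = T^{(k)} × Fin d`): `Lap + a′•Kproj = DeltaPs ⊗ₖ 1`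

NE2 formalisation swarm `b2b-balaban-t4-ne2-formalise-*`, leaf 09 (support row B4.c).  Row B4.d (leaf-04) realises the `U = 1` scalar
layer of the gauge term ([Balaban1985BackgroundPropagators] (3.24) p.394 «Δ′_a = Δ^η_U + Q′*aQ′» at `U = 1`) componentwise on the
vector index, with the unit-block projection tower `Kproj L M k = (L^d)^k•(Atow Q k)ᴴ(Atow Q k)` built from King's one-step averagings;
row B4.c (files 1–3b) proved coercivity, the one-derivative bounds and `n₁` for the genuine 0-form operator `DeltaPs n M a′ = LapS + a′•PiS`
(`PiS = n^d·Q′ᴴQ′`, [Balaban1984PropagatorsI] (1.20) blocks).  THIS FILE identifies the two realisations EXACTLY, so that nothing is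
proved twice:

 * §1 `shiftM N ν = shiftS N ν ⊗ₖ 1`, `fdiff N c ν = sdiff N c ν ⊗ₖ 1`, **`Lap_eq_kron`**: `Lap n M = LapS (fine n M) n ⊗ₖ 1`;
 * §2 block bookkeeping (`val_blockOf`, `blockOf_par`, `PiS_apply` imported from row B4.d's `ScalarPlantingDefect`), `PiS 1 M = 1`,
   King's sandwich entries `JK_sandwich_apply`
   (`(J_L Z J_Lᴴ)(x′, y′) = L^{−d}·Z(par x′, par y′)`), and the ONE-STEP IDENTITY **`JK_kronPiS_JKH`**:
   `J_L·(PiS n ⊗ₖ 1)·J_Lᴴ = PiS (L·n) ⊗ₖ 1`;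
 * §3 **`Kproj_eq_kron`**: `Kproj L M k = PiS (lev L k) M ⊗ₖ 1` (induction on `ScalarMassTower.Kproj_succ`), hence
   **`scalarLayer_eq_kron`**: `Lap (lev L k) M + a′•Kproj L M k = DeltaPs (lev L k) M a′ ⊗ₖ 1`, its inverse `= Gps ⊗ₖ 1`, and the
   TRANSFERRED `U = 1` bounds on the vector index (`KroneckerLift.opNorm_kron_le`): `‖(Lap + a′Kproj)⁻¹‖ ≤ γ′⁻¹`,
   `‖fdiff ν·(Lap + a′Kproj)⁻¹‖ ≤ √(γ′⁻¹)`, `‖(Lap + a′Kproj)⁻¹·(fdiff ν)ᴴ‖ ≤ √(γ′⁻¹)`, `‖fdiff ν·(Lap + a′Kproj)⁻¹·(fdiff μ)ᴴ‖ ≤ 1`,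
   `γ′ = gammaPs d a′ = (1 + max (2/a′) (8d))⁻¹` — for rows B4.d / B4.b / B4.e to import by name.

HONEST FRAMING (T4-DAG p. 1).  [folklore] index bookkeeping about the cell's typed `U = 1` objects; statements OURS; nothing printed is a
hypothesis.  `U = 1`, FIXED FINITE torus, scalar layer; a SUPPORT input of rows B4.b/B4.d, NOT B4, NOT [B9] (3.23)–(3.26) as printed;
NE2 NOT proved; spine 0/9 unchanged; NOT infinite volume / mass gap / Clay / summit progress.  HONEST DEPENDENCY: continuum YM on T⁴ ⇐
BetaPertH ∧ nine spine estimates (0/9 proved); BetaPertH ⇐ (D1) ∧ (D4) ∧ CAP+tail; G-an2-4 gates asym, D1 and NE2/3/4.  ABSOLUTE RULE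
kept; zero sorries.
-/

noncomputable section

open scoped BigOperators ComplexConjugate ComplexOrder Matrix Matrix.Norms.L2Operator Kronecker
open Finset

namespace Summit.QuantumFields.BalabanUV.T4Continuum.ScalarLayerKronBridge

open Literature.MathematicalPhysics.QuantumFieldTheory.Balaban1983to89.B5Prop11Plancherel
open Literature.MathematicalPhysics.QuantumFieldTheory.Balaban1983to89.B5Prop11Lower (nsq nsq_nonneg Lap)
open Literature.MathematicalPhysics.QuantumFieldTheory.Balaban1983to89.B5Action121 (shiftS sdiff LapS)
open Literature.MathematicalPhysics.QuantumFieldTheory.Balaban1983to89.B5Block118 (bpt QsOp)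
open Literature.MathematicalPhysics.QuantumFieldTheory.Balaban1983to89.B5Blocks16 (bpt_bijective bpt_val blockOf blockOf_bpt)
open Literature.MathematicalPhysics.QuantumFieldTheory.Balaban1983to89.B5G183RateTorusW (Qavg)
open Literature.MathematicalPhysics.QuantumFieldTheory.Balaban1983to89.B5G183RateUnitTower (lev lev_neZero)
open Summit.QuantumFields.BalabanUV.T4Continuum.BalabanAveragedTowerUnit (idx)
open Summit.QuantumFields.BalabanUV.T4Continuum.BalabanAveragedTowerModes (par val_par)
open Summit.QuantumFields.BalabanUV.T4Continuum.BalabanBlockPoincare (Qavg_conjTranspose_mul_apply)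
open Summit.QuantumFields.BalabanUV.T4Continuum.KingPairingPlantedLaw (JK JpcT JpcT_eq_JK sqrt_facts)
open Summit.QuantumFields.BalabanUV.T4Continuum.ScalarMassTower (Kproj Kproj_zero Kproj_succ)
open Summit.QuantumFields.BalabanUV.T4Continuum.KroneckerLift
open Summit.QuantumFields.BalabanUV.T4Continuum.ScalarBlockPoincare
open Summit.QuantumFields.BalabanUV.T4Continuum.ScalarAveragedPropagator
open Summit.QuantumFields.BalabanUV.T4Continuum.ScalarPlantingDefect (val_blockOf blockOf_par PiS_apply)

variable {d : ℕ}

/-! ## §1 `shiftM`, `fdiff`, `Lap` are the 0-form operators tensored with the identity on components -/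

section LapKron

variable (N : Fin d → ℕ) [hN : ∀ μ, NeZero (N μ)]

omit hN in
/-- `S_ν` on 1-forms is `S_ν ⊗ 1` (0-forms ⊗ components). [folklore] -/
theorem shiftM_eq_kron (ν : Fin d) : shiftM N ν = shiftS N ν ⊗ₖ (1 : Matrix (Fin d) (Fin d) ℂ) := by
  ext ⟨x, μ⟩ ⟨y, μ'⟩
  simp only [shiftM, shiftS, Matrix.kroneckerMap_apply, Matrix.one_apply, Prod.mk.injEq]
  by_cases h1 : y = x + unitVec N ν <;> by_cases h2 : μ = μ' <;> simp [h1, h2, eq_comm]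

omit hN in
/-- `∇_ν = ∂_ν ⊗ 1`. [folklore] -/
theorem fdiff_eq_kron (c : ℂ) (ν : Fin d) : fdiff N c ν = sdiff N c ν ⊗ₖ (1 : Matrix (Fin d) (Fin d) ℂ) := by
  unfold fdiff Literature.MathematicalPhysics.QuantumFieldTheory.Balaban1983to89.B5Action121.sdiff
  rw [shiftM_eq_kron, Matrix.smul_kronecker, sub_kronecker, Matrix.one_kronecker_one]

omit hN in
/-- finite sums pass through the left Kronecker factor. [folklore] -/
theorem sum_kron {ι' m : Type*} (s : Finset ι') (f : ι' → Matrix (Tor N) (Tor N) ℂ) (C : Matrix m m ℂ) :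
    (∑ i ∈ s, f i) ⊗ₖ C = ∑ i ∈ s, f i ⊗ₖ C := by
  classical
  induction s using Finset.induction_on with
  | empty => simp
  | @insert a s ha ih => rw [Finset.sum_insert ha, Finset.sum_insert ha, Matrix.add_kronecker, ih]

end LapKron

section LapLevel

variable (n : ℕ) [NeZero n] (M : Fin d → ℕ) [hM : ∀ μ, NeZero (M μ)]

/-- **`Lap = LapS ⊗ 1`**: the componentwise vector Laplacian of (1.21)/(1.90) is the scalar one tensored with `1_{Fin d}`. [folklore] -/
theorem Lap_eq_kron : Lap n M = LapS (fine n M) (n : ℂ) ⊗ₖ (1 : Matrix (Fin d) (Fin d) ℂ) := by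
  rw [Lap, LapS, sum_kron]
  refine Finset.sum_congr rfl fun ν _ => ?_
  rw [fdiff_eq_kron, kron_mul, kron_conjTranspose]

/-! ## §2 Block bookkeeping and King's one-step sandwich of `PiS ⊗ 1` -/

/-- `PiS 1 M = 1` (blocks of one site). [folklore] -/
theorem PiS_one_eq : PiS 1 M = 1 := by
  ext x y
  rw [PiS_apply, Matrix.one_apply]
  have hinj : blockOf 1 M x = blockOf 1 M y ↔ x = y := by
    constructor
    · intro h
      funext ν
      apply ZMod.val_injective
      have hx := val_blockOf M 1 x ν
      have hy := val_blockOf M 1 y ν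
      rw [Nat.div_one] at hx hy
      rw [← hx, ← hy, h]
    · intro h; rw [h]
  simp only [hinj, Nat.cast_one, one_pow, inv_one]

end LapLevel

section OneStep

variable (n L : ℕ) [NeZero n] [NeZero L] (M : Fin d → ℕ) [hM : ∀ μ, NeZero (M μ)]

/-- **King's sandwich, entrywise**: `(J_L Z J_Lᴴ)(x′, y′) = L^{−d}·Z((par x′₁, x′₂), (par y′₁, y′₂))`. [folklore] -/
theorem JK_sandwich_apply (Z : Matrix (Tor (fine n M) × Fin d) (Tor (fine n M) × Fin d) ℂ)
    (x' y' : Tor (fine (L * n) M) × Fin d) :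
    (JK n L M * Z * (JK n L M)ᴴ) x' y' = (((L : ℂ) ^ d))⁻¹ * Z (par n L M x'.1, x'.2) (par n L M y'.1, y'.2) := by
  have hLd : ((L : ℂ) ^ d) ≠ 0 := pow_ne_zero _ (by exact_mod_cast NeZero.ne L)
  obtain ⟨hs, hss⟩ := sqrt_facts (d := d) L
  have e : JK n L M * Z * (JK n L M)ᴴ = ((L : ℂ) ^ d) • ((Qavg n L M)ᴴ * (Z * Qavg n L M)) := by
    rw [JK, Matrix.conjTranspose_smul, Matrix.conjTranspose_conjTranspose, hs, Matrix.smul_mul, Matrix.smul_mul, Matrix.mul_smul,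
      smul_smul, hss, Matrix.mul_assoc]
  have e2 : (Z * Qavg n L M) (par n L M x'.1, x'.2) y' = (((L : ℂ) ^ d))⁻¹ * Z (par n L M x'.1, x'.2) (par n L M y'.1, y'.2) := by
    have h := Qavg_conjTranspose_mul_apply n L M Zᴴ y' (par n L M x'.1, x'.2)
    have h2 : (Z * Qavg n L M) (par n L M x'.1, x'.2) y' = star (((Qavg n L M)ᴴ * Zᴴ) y' (par n L M x'.1, x'.2)) := by
      rw [← Matrix.conjTranspose_apply, Matrix.conjTranspose_mul, Matrix.conjTranspose_conjTranspose, Matrix.conjTranspose_conjTranspose]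
    rw [h2, h, star_mul', Matrix.conjTranspose_apply, star_star, star_inv₀, star_pow, star_natCast]
  rw [e, Matrix.smul_apply, smul_eq_mul, Qavg_conjTranspose_mul_apply, e2, ← mul_assoc, ← mul_assoc, mul_inv_cancel₀ hLd, one_mul]

/-- **THE ONE-STEP IDENTITY** `J_L·(PiS n ⊗ₖ 1)·J_Lᴴ = PiS (L·n) ⊗ₖ 1`: planting then projecting onto the coarser unit blocks is the
finer unit-block projection. [folklore] -/
theorem JK_kronPiS_JKH : JK n L M * (PiS n M ⊗ₖ (1 : Matrix (Fin d) (Fin d) ℂ)) * (JK n L M)ᴴ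
    = PiS (L * n) M ⊗ₖ (1 : Matrix (Fin d) (Fin d) ℂ) := by
  have hLd : ((L : ℂ) ^ d) ≠ 0 := pow_ne_zero _ (by exact_mod_cast NeZero.ne L)
  have hnd : ((n : ℂ) ^ d) ≠ 0 := pow_ne_zero _ (by exact_mod_cast NeZero.ne n)
  ext ⟨x', μ⟩ ⟨y', μ'⟩
  rw [JK_sandwich_apply, Matrix.kroneckerMap_apply, Matrix.kroneckerMap_apply]
  dsimp only
  rw [PiS_apply, PiS_apply, blockOf_par, blockOf_par]
  by_cases h : blockOf (L * n) M x' = blockOf (L * n) M y'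
  · rw [if_pos h, if_pos h, ← mul_assoc]
    congr 1
    push_cast
    rw [mul_pow, mul_inv]
  · rw [if_neg h, if_neg h, zero_mul, mul_zero]

end OneStep

/-! ## §3 `Kproj = PiS ⊗ 1` along the tower; `Lap + a′Kproj = DeltaPs ⊗ 1`; transferred bounds -/

section Tower

variable (L : ℕ) [NeZero L] (M : Fin d → ℕ) [hM : ∀ μ, NeZero (M μ)]

/-- **`Kproj L M k = PiS (lev L k) M ⊗ₖ 1`**: row B4.d's unit-block projection tower IS the 0-form block-mean projector of row B4.c,
componentwise. [folklore] -/
theorem Kproj_eq_kron (k : ℕ) : Kproj L M k = PiS (lev L k) M ⊗ₖ (1 : Matrix (Fin d) (Fin d) ℂ) := by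
  induction k with
  | zero =>
    rw [Kproj_zero]
    show (1 : Matrix (idx L M 0) (idx L M 0) ℂ) = PiS 1 M ⊗ₖ (1 : Matrix (Fin d) (Fin d) ℂ)
    rw [PiS_one_eq, Matrix.one_kronecker_one]
    rfl
  | succ k ih =>
    rw [Kproj_succ, ih, JpcT_eq_JK]
    exact JK_kronPiS_JKH (lev L k) L M

variable (a' : ℝ)

/-- **`Lap + a′•Kproj = DeltaPs ⊗ₖ 1` at every level**: the vector-index realisation of the `U = 1` scalar layer is the 0-form
operator `Δ + a′Π′` tensored with `1_{Fin d}`. [folklore] -/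
theorem scalarLayer_eq_kron (k : ℕ) :
    Lap (lev L k) M + (a' : ℂ) • Kproj L M k = DeltaPs (lev L k) M a' ⊗ₖ (1 : Matrix (Fin d) (Fin d) ℂ) := by
  rw [DeltaPs, Matrix.add_kronecker, Matrix.smul_kronecker, ← Kproj_eq_kron, ← Lap_eq_kron]

/-- its inverse is `Gps ⊗ₖ 1`. [folklore] -/
theorem scalarLayer_inv_eq_kron (k : ℕ) :
    (Lap (lev L k) M + (a' : ℂ) • Kproj L M k)⁻¹ = Gps (lev L k) M a' ⊗ₖ (1 : Matrix (Fin d) (Fin d) ℂ) := by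
  rw [scalarLayer_eq_kron, kron_inv, Gps]

variable {a'}

/-- invertibility on the vector index. [folklore] -/
theorem isUnit_det_scalarLayer (ha' : 0 < a') (k : ℕ) : IsUnit (Lap (lev L k) M + (a' : ℂ) • Kproj L M k).det := by
  rw [scalarLayer_eq_kron]; exact isUnit_det_kron _ (isUnit_det_DeltaPs (lev L k) M ha')

/-- **`‖(Lap + a′Kproj)⁻¹‖ ≤ γ′⁻¹`** on the vector index, uniformly in `k`. [folklore] -/
theorem opNorm_scalarLayer_inv_le (ha' : 0 < a') (k : ℕ) : ‖(Lap (lev L k) M + (a' : ℂ) • Kproj L M k)⁻¹‖ ≤ (gammaPs d a')⁻¹ := by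
  rw [scalarLayer_inv_eq_kron]; exact opNorm_kron_le_of_le _ (opNorm_Gps_le (lev L k) M ha')

/-- **`‖∇_ν (Lap + a′Kproj)⁻¹‖ ≤ √(γ′⁻¹)`** on the vector index. [folklore] -/
theorem opNorm_fdiff_mul_scalarLayer_inv_le (ha' : 0 < a') (k : ℕ) (ν : Fin d) :
    ‖fdiff (fine (lev L k) M) ((lev L k : ℕ) : ℂ) ν * (Lap (lev L k) M + (a' : ℂ) • Kproj L M k)⁻¹‖ ≤ Real.sqrt ((gammaPs d a')⁻¹) := by
  rw [scalarLayer_inv_eq_kron, fdiff_eq_kron, ← kron_mul]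
  exact opNorm_kron_le_of_le _ (opNorm_sdiff_mul_Gps_le (lev L k) M ha' ν)

/-- **`‖(Lap + a′Kproj)⁻¹ ∇_νᴴ‖ ≤ √(γ′⁻¹)`** on the vector index. [folklore] -/
theorem opNorm_scalarLayer_inv_mul_fdiffH_le (ha' : 0 < a') (k : ℕ) (ν : Fin d) :
    ‖(Lap (lev L k) M + (a' : ℂ) • Kproj L M k)⁻¹ * (fdiff (fine (lev L k) M) ((lev L k : ℕ) : ℂ) ν)ᴴ‖ ≤ Real.sqrt ((gammaPs d a')⁻¹) := by
  rw [scalarLayer_inv_eq_kron, fdiff_eq_kron, kron_conjTranspose, ← kron_mul]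
  exact opNorm_kron_le_of_le _ (opNorm_Gps_mul_sdiffH_le (lev L k) M ha' ν)

/-- **`‖∇_ν (Lap + a′Kproj)⁻¹ ∇_μᴴ‖ ≤ 1`** on the vector index. [folklore] -/
theorem opNorm_fdiff_scalarLayer_inv_fdiffH_le (ha' : 0 < a') (k : ℕ) (ν μ : Fin d) :
    ‖fdiff (fine (lev L k) M) ((lev L k : ℕ) : ℂ) ν * (Lap (lev L k) M + (a' : ℂ) • Kproj L M k)⁻¹
        * (fdiff (fine (lev L k) M) ((lev L k : ℕ) : ℂ) μ)ᴴ‖ ≤ 1 := by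
  rw [scalarLayer_inv_eq_kron, fdiff_eq_kron, fdiff_eq_kron, kron_conjTranspose, ← kron_mul, ← kron_mul]
  exact opNorm_kron_le_of_le _ (opNorm_sdiff_Gps_sdiffH_le (lev L k) M ha' ν μ)

end Tower

end Summit.QuantumFields.BalabanUV.T4Continuum.ScalarLayerKronBridge

end
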